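import Literature.AnabelianGeometry.EtaleTheta.Thm56SubdagProofs
import Literature.AnabelianGeometry.EtaleTheta.Discharge.Sec5ReachableFromBNForcesDepth

/-!
# [EtTh] Prop. 5.5 from print's ROOFS `S″ → S`, `S″ → B_N` (p.328 / PDF p.102): the EXISTENCE half, the uniqueness glue and
# `CyclotomicRigidity` — the roof-form twins of abc-iut-w5-d020's `rigidityFamily_exists_of` and abc-iut-L2-t11's `cyclotomicRigidity_of`

S. Mochizuki, *The étale theta function and its Frobenioid-theoretic manifestations*, Publ. RIMS **45** (2009) [MochizukiEtTh2009], proof of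
Prop. 5.5 p.327–328 (PDF pp.101–102): «we may transport this isomorphism from `S′` to an arbitrary `(l, N)`-theta-saturated `S ∈ Ob(C)` by
means of linear morphisms `S″ → S`, `S″ → S′` … which induce isomorphisms … — hence also a [functorial] isomorphism `(l·Δ_Θ)_S ⊗ ℤ/Nℤ ⥲
μ_N(S)`, which is independent of the choice of `S″`, … and the linear morphisms `S″ → S`, `S″ → S′` [precisely because of the original
"functoriality" of the isomorphism for `S′`]».

abc-iut cell, layer L2, seat abc-iut-w5-d013 (gen 5); sequel of the FINDING F-w5d013g5-1 (`Sec5ReachableFromBNForcesDepth.lean`, p451685: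
the fixed-source transport `LinearlyReachableFromBN` / `BijectivelyReachableFromBN` forces every theta-saturated object UNDER `B_N^bs`; abc-iut-L2-lead
R459: «hreach → roof» is the binder of record for the uniqueness half).  PROOF-ONLY (no definition, no new named fact; the roof hypotheses are
spelled as ∀/∃-binders verbatim — a predicate name for them is the K4 custodian's to file); nothing landed is edited or restated.

THIS FILE = the roof-form twins, with print's TWO arrows from a theta-saturated `S″` (here `R`):
* `rigidityFamily_exists_of_roofs` — **the EXISTENCE half** (twin of abc-iut-w5-d020's `Thm56Sub.rigidityFamily_exists_of`, P55-A): from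
  `ν : (l·Δ_Θ)_{B_N} ⊗ ℤ/Nℤ ⥲ μ_N(B_N)`, a ROOF for every theta-saturated `S` — a theta-saturated `R`, a linear `a : R ⟶ S` inducing BIJECTIONS on
  `(l·Δ_Θ) ⊗ ℤ/Nℤ` and `μ_N`, a linear `b : R ⟶ B_N` — the ROOF-INDEPENDENCE of the transport (print's «independent of the choice …», the
  two-arrow twin of `TransportIndependent`: the relation «`y = a_*(x)` and `a^*(u) = b^*(ν(b_* x))`» on `(l·Δ_Θ)_T ⊗ ℤ/Nℤ × μ_N(T)` does not
  depend on the roof `(R, a, b)` of `T`) and the transport laws P55-L06b: a rigidity family extending `ν` and functorial for linear morphisms —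
  `ρ_S := (a^*)⁻¹ ∘ b^* ∘ ν ∘ b_* ∘ (a_*)⁻¹`;
* `cyclotomicRigidity_unique_of_roofs` / `cyclotomicRigidity_of_roofs` — abc-iut-L2-t11's glue with abc-iut-L2-t4's `rigidityFamily_unique_of`
  replaced by this seat's `rigidityFamily_unique_of_roof` (p451685);
* `cyclotomicRigidity_of_sub_roofs` — abc-iut-L2-t4's `CyclotomicRigidity P hB` (Prop. 5.5) MODULO the sub-DAG inputs with `hreach`/`hind`
  replaced by their roof forms (twin of `cyclotomicRigidity_of_sub`).
So the K4 chain can swap the unsatisfiable-at-depth binder for print's roof WITHOUT losing Prop. 5.5.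
HONEST FRAMING: kernel-checked implications between typed statements; the roof data and their independence are HYPOTHESES (print derives
them from [FrdI] Def. 1.3 (i)(b)/(c) and the functoriality at `l·N`-codomains — not formalised here); nothing asserts that such data exist for
an actual curve; [EtTh] is refereed pre-IUT material; nothing here bears on [IUTchIII] Cor. 3.12 — no side is taken; typed ≠ proved.
-/

namespace Literature.AnabelianGeometry.EtaleTheta

open CategoryTheory FrobenioidCyclotomicRigidity Literature.AlgebraicGeometry.Frobenioids

universe w v v' u u'

namespace ThetaFrobenioid

namespace Thm56Sub

variable {C : Type u} [Category.{v} C] {D : Type u'} [Category.{v'} D] {𝔉 : ThetaFrobenioid.{w} C D}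

/-- **Prop. 5.5, EXISTENCE half, from ROOFS** (twin of `rigidityFamily_exists_of`): given `ν` at `B_N`, for every theta-saturated `S` a
ROOF `B_N ⟵b R a⟶ S` — theta-saturated `R`, linear legs inducing BIJECTIONS on `(l·Δ_Θ) ⊗ ℤ/Nℤ` and `μ_N` («which induce isomorphisms»,
both legs) — the roof-independence of the transport, and the laws P55-L06b: there is a rigidity family extending `ν` and functorial for
linear morphisms, `ρ_S := (a^*)⁻¹ ∘ b^* ∘ ν ∘ b_* ∘ (a_*)⁻¹`.  [cite: MochizukiEtTh2009, Prop 5.5 proof p.328 (PDF p.102)] -/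
theorem rigidityFamily_exists_of_roofs (hB : 𝔉.IsThetaSaturated 𝔉.BN)
    (ν : 𝔉.lDeltaModN 𝔉.BN ≃* 𝔉.muTorsion 𝔉.BN 𝔉.N)
    (hroof : ∀ S : C, 𝔉.IsThetaSaturated S → ∃ (R : C) (_ : 𝔉.IsThetaSaturated R) (a : R ⟶ S) (b : R ⟶ 𝔉.BN),
      𝔉.IsLinear a ∧ 𝔉.IsLinear b ∧ Function.Bijective (𝔉.lDeltaModNMap a) ∧ Function.Bijective (𝔉.muTorsionPull a 𝔉.N) ∧
        Function.Bijective (𝔉.lDeltaModNMap b) ∧ Function.Bijective (𝔉.muTorsionPull b 𝔉.N))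
    (hind : ∀ (T : C), 𝔉.IsThetaSaturated T →
      ∀ (R : C), 𝔉.IsThetaSaturated R → ∀ (a : R ⟶ T) (b : R ⟶ 𝔉.BN), 𝔉.IsLinear a → 𝔉.IsLinear b →
      ∀ (R' : C), 𝔉.IsThetaSaturated R' → ∀ (a' : R' ⟶ T) (b' : R' ⟶ 𝔉.BN), 𝔉.IsLinear a' → 𝔉.IsLinear b' →
      ∀ (x : 𝔉.lDeltaModN R) (x' : 𝔉.lDeltaModN R') (u : 𝔉.muTorsion T 𝔉.N),
        𝔉.lDeltaModNMap a x = 𝔉.lDeltaModNMap a' x' →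
        𝔉.muTorsionPull a 𝔉.N u = 𝔉.muTorsionPull b 𝔉.N (ν (𝔉.lDeltaModNMap b x)) →
        𝔉.muTorsionPull a' 𝔉.N u = 𝔉.muTorsionPull b' 𝔉.N (ν (𝔉.lDeltaModNMap b' x')))
    (hUc : UnitsPullComp 𝔉) (hUi : UnitsPullId 𝔉) (hLc : LDeltaMapComp 𝔉) (hLi : LDeltaMapId 𝔉) :
    ∃ ρ : RigidityFamily 𝔉, (∀ x, ρ 𝔉.BN hB x = ν x) ∧ IsFunctorialLinear 𝔉 ρ := by
  classical
  choose R hR a b ha hb hΔa hμa hΔb hμb using hroof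
  -- the four induced isomorphisms along the legs of the chosen roof of `S`
  let EΔa : ∀ S (hS : 𝔉.IsThetaSaturated S), 𝔉.lDeltaModN (R S hS) ≃* 𝔉.lDeltaModN S := fun S hS =>
    MulEquiv.ofBijective (𝔉.lDeltaModNMap (a S hS)) (hΔa S hS)
  let Eμa : ∀ S (hS : 𝔉.IsThetaSaturated S), 𝔉.muTorsion S 𝔉.N ≃* 𝔉.muTorsion (R S hS) 𝔉.N := fun S hS =>
    MulEquiv.ofBijective (𝔉.muTorsionPull (a S hS) 𝔉.N) (hμa S hS)
  let EΔb : ∀ S (hS : 𝔉.IsThetaSaturated S), 𝔉.lDeltaModN (R S hS) ≃* 𝔉.lDeltaModN 𝔉.BN := fun S hS =>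
    MulEquiv.ofBijective (𝔉.lDeltaModNMap (b S hS)) (hΔb S hS)
  let Eμb : ∀ S (hS : 𝔉.IsThetaSaturated S), 𝔉.muTorsion 𝔉.BN 𝔉.N ≃* 𝔉.muTorsion (R S hS) 𝔉.N := fun S hS =>
    MulEquiv.ofBijective (𝔉.muTorsionPull (b S hS) 𝔉.N) (hμb S hS)
  -- `ρ_S := (a^*)⁻¹ ∘ b^* ∘ ν ∘ b_* ∘ (a_*)⁻¹`
  let ρ : RigidityFamily 𝔉 := fun S hS =>
    ((((EΔa S hS).symm.trans (EΔb S hS)).trans ν).trans (Eμb S hS)).trans (Eμa S hS).symm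
  -- its defining relation, read through the chosen roof
  have hchar : ∀ S (hS : 𝔉.IsThetaSaturated S) (y : 𝔉.lDeltaModN S),
      𝔉.muTorsionPull (a S hS) 𝔉.N (ρ S hS y) =
        𝔉.muTorsionPull (b S hS) 𝔉.N (ν (𝔉.lDeltaModNMap (b S hS) ((EΔa S hS).symm y))) := by
    intro S hS y
    change (Eμa S hS) ((Eμa S hS).symm ((Eμb S hS) (ν ((EΔb S hS) ((EΔa S hS).symm y))))) = _
    rw [MulEquiv.apply_symm_apply]
    rfl
  have hEΔa : ∀ S (hS : 𝔉.IsThetaSaturated S) (y : 𝔉.lDeltaModN S),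
      𝔉.lDeltaModNMap (a S hS) ((EΔa S hS).symm y) = y := fun S hS y => (EΔa S hS).apply_symm_apply y
  refine ⟨ρ, ?_, ?_⟩
  · -- at `B_N`: compare the chosen roof of `B_N` with the trivial roof `(B_N, 𝟙, 𝟙)` (roof-independence)
    intro x
    have key := hind 𝔉.BN hB (R 𝔉.BN hB) (hR 𝔉.BN hB) (a 𝔉.BN hB) (b 𝔉.BN hB) (ha 𝔉.BN hB) (hb 𝔉.BN hB)
      𝔉.BN hB (𝟙 𝔉.BN) (𝟙 𝔉.BN) (𝔉.pre.degFr_id 𝔉.BN) (𝔉.pre.degFr_id 𝔉.BN) ((EΔa 𝔉.BN hB).symm x) x (ρ 𝔉.BN hB x)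
      (by rw [hEΔa, lDeltaModNMap_id hLi]) (hchar 𝔉.BN hB x)
    rw [muTorsionPull_id hUi, lDeltaModNMap_id hLi, muTorsionPull_id hUi] at key
    exact key
  · -- functoriality for a linear `ψ : S → T`: roof-independence at `T` between `T`'s roof and `(R_S, a_S ≫ ψ, b_S)`
    intro S T ψ hψ hS hT x
    set x₁ := (EΔa S hS).symm x with hx₁
    have hx : 𝔉.lDeltaModNMap (a S hS) x₁ = x := hEΔa S hS x
    have key := hind T hT (R T hT) (hR T hT) (a T hT) (b T hT) (ha T hT) (hb T hT)
      (R S hS) (hR S hS) (a S hS ≫ ψ) (b S hS) (isLinear_comp (ha S hS) hψ) (hb S hS)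
      ((EΔa T hT).symm (𝔉.lDeltaModNMap ψ x)) x₁ (ρ T hT (𝔉.lDeltaModNMap ψ x))
      (by rw [hEΔa, lDeltaModNMap_comp hLc, hx]) (hchar T hT _)
    rw [muTorsionPull_comp hUc] at key
    -- `a_S^*` is injective: compare with `a_S^* (ρ_S x) = b_S^* (ν (b_{S*} x₁))`
    apply (hμa S hS).1
    rw [key, hchar S hS x]

/-- **Prop. 5.5, uniqueness glue from ROOFS** (twin of abc-iut-L2-t11's `cyclotomicRigidity_unique_of`): two Kummer-determined rigidity
families functorial for linear morphisms coincide — they agree at `B_N` (`rigidityFamily_eq_on_BN_of_isKummerDetermined`, coverage `hcov`)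
and the roofs transport the agreement (`rigidityFamily_unique_of_roof`).  [cite: MochizukiEtTh2009, Prop 5.5 proof p.328 (PDF p.102)] -/
theorem cyclotomicRigidity_unique_of_roofs (P : ThetaSubquotientProj 𝔉) (hB : 𝔉.IsThetaSaturated 𝔉.BN)
    (hroof : ∀ S : C, 𝔉.IsThetaSaturated S → ∃ (R : C) (_ : 𝔉.IsThetaSaturated R) (b : R ⟶ 𝔉.BN) (a : R ⟶ S),
      𝔉.IsLinear b ∧ 𝔉.IsLinear a ∧ Function.Surjective (𝔉.lDeltaModNMap a) ∧ Function.Injective (𝔉.muTorsionPull a 𝔉.N))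
    (hcov : ∀ x : 𝔉.lDeltaModN 𝔉.BN, ∃ (h : 𝔉.HB)
      (hh : (h : Aut (𝔉.base.obj 𝔉.BN)) ∈ P.pre (𝔉.base.obj 𝔉.BN)),
      (QuotientGroup.mk (P.proj _ ⟨h, hh⟩) : 𝔉.lDeltaModN 𝔉.BN) = x)
    (ρ ρ' : RigidityFamily 𝔉) (hK : IsKummerDetermined 𝔉 P ρ hB) (hF : IsFunctorialLinear 𝔉 ρ)
    (hK' : IsKummerDetermined 𝔉 P ρ' hB) (hF' : IsFunctorialLinear 𝔉 ρ') : ρ = ρ' :=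
  rigidityFamily_unique_of_roof 𝔉 hroof hB hF hF' (𝔉.rigidityFamily_eq_on_BN_of_isKummerDetermined P hB hcov hK hK')

/-- **[EtTh] Prop. 5.5 DISCHARGED MODULO its existence half, from ROOFS** (twin of abc-iut-L2-t11's `cyclotomicRigidity_of`).
[cite: MochizukiEtTh2009, Prop 5.5 p.327 (PDF p.101)] -/
theorem cyclotomicRigidity_of_roofs (P : ThetaSubquotientProj 𝔉) (hB : 𝔉.IsThetaSaturated 𝔉.BN)
    (hroof : ∀ S : C, 𝔉.IsThetaSaturated S → ∃ (R : C) (_ : 𝔉.IsThetaSaturated R) (b : R ⟶ 𝔉.BN) (a : R ⟶ S),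
      𝔉.IsLinear b ∧ 𝔉.IsLinear a ∧ Function.Surjective (𝔉.lDeltaModNMap a) ∧ Function.Injective (𝔉.muTorsionPull a 𝔉.N))
    (hcov : ∀ x : 𝔉.lDeltaModN 𝔉.BN, ∃ (h : 𝔉.HB)
      (hh : (h : Aut (𝔉.base.obj 𝔉.BN)) ∈ P.pre (𝔉.base.obj 𝔉.BN)),
      (QuotientGroup.mk (P.proj _ ⟨h, hh⟩) : 𝔉.lDeltaModN 𝔉.BN) = x)
    (hex : ∃ ρ : RigidityFamily 𝔉, IsKummerDetermined 𝔉 P ρ hB ∧ IsFunctorialLinear 𝔉 ρ) :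
    CyclotomicRigidity 𝔉 P hB :=
  ⟨hex, cyclotomicRigidity_unique_of_roofs P hB hroof hcov⟩

/-- **[EtTh] Prop. 5.5 (`CyclotomicRigidity P hB`, existence ∧ uniqueness) MODULO the sub-DAG inputs, ROOF FORM** — twin of
abc-iut-w5-d020's `cyclotomicRigidity_of_sub` with P55-L05 (`BijectivelyReachableFromBN`) and P55-L06 (`TransportIndependent`) replaced by
print's two-arrow roof data and their independence; the other inputs (Prop. 5.2 (iii) pin, `EtaTautological`, `UnitsCentralUnderLDelta`,
P55-L06b laws, coverage) unchanged.  [cite: MochizukiEtTh2009, Prop 5.5 p.327–328 (PDF pp.101–102)] -/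
theorem cyclotomicRigidity_of_sub_roofs (P : ThetaSubquotientProj 𝔉) (hB : 𝔉.IsThetaSaturated 𝔉.BN)
    {η : 𝔉.HB → 𝔉.lDeltaModN 𝔉.BN} {ν : 𝔉.lDeltaModN 𝔉.BN ≃* 𝔉.muTorsion 𝔉.BN 𝔉.N}
    (hK : FrobenioidThetaBiKummer.ThetaPairKummerClass 𝔉 η ν) (hη : EtaTautological 𝔉 P η)
    (hcentral : UnitsCentralUnderLDelta 𝔉 P)
    (hroof : ∀ S : C, 𝔉.IsThetaSaturated S → ∃ (R : C) (_ : 𝔉.IsThetaSaturated R) (a : R ⟶ S) (b : R ⟶ 𝔉.BN),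
      𝔉.IsLinear a ∧ 𝔉.IsLinear b ∧ Function.Bijective (𝔉.lDeltaModNMap a) ∧ Function.Bijective (𝔉.muTorsionPull a 𝔉.N) ∧
        Function.Bijective (𝔉.lDeltaModNMap b) ∧ Function.Bijective (𝔉.muTorsionPull b 𝔉.N))
    (hind : ∀ (T : C), 𝔉.IsThetaSaturated T →
      ∀ (R : C), 𝔉.IsThetaSaturated R → ∀ (a : R ⟶ T) (b : R ⟶ 𝔉.BN), 𝔉.IsLinear a → 𝔉.IsLinear b →
      ∀ (R' : C), 𝔉.IsThetaSaturated R' → ∀ (a' : R' ⟶ T) (b' : R' ⟶ 𝔉.BN), 𝔉.IsLinear a' → 𝔉.IsLinear b' →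
      ∀ (x : 𝔉.lDeltaModN R) (x' : 𝔉.lDeltaModN R') (u : 𝔉.muTorsion T 𝔉.N),
        𝔉.lDeltaModNMap a x = 𝔉.lDeltaModNMap a' x' →
        𝔉.muTorsionPull a 𝔉.N u = 𝔉.muTorsionPull b 𝔉.N (ν (𝔉.lDeltaModNMap b x)) →
        𝔉.muTorsionPull a' 𝔉.N u = 𝔉.muTorsionPull b' 𝔉.N (ν (𝔉.lDeltaModNMap b' x')))
    (hUc : UnitsPullComp 𝔉) (hUi : UnitsPullId 𝔉) (hLc : LDeltaMapComp 𝔉) (hLi : LDeltaMapId 𝔉)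
    (hcov : LDeltaCovered 𝔉 P) : CyclotomicRigidity 𝔉 P hB := by
  obtain ⟨ρ, hρB, hρ⟩ := rigidityFamily_exists_of_roofs hB ν hroof hind hUc hUi hLc hLi
  have hroof' : ∀ S : C, 𝔉.IsThetaSaturated S → ∃ (R : C) (_ : 𝔉.IsThetaSaturated R) (b : R ⟶ 𝔉.BN) (a : R ⟶ S),
      𝔉.IsLinear b ∧ 𝔉.IsLinear a ∧ Function.Surjective (𝔉.lDeltaModNMap a) ∧
        Function.Injective (𝔉.muTorsionPull a 𝔉.N) := fun S hS => by
    obtain ⟨R, hR, a, b, ha, hb, hΔa, hμa, -, -⟩ := hroof S hS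
    exact ⟨R, hR, b, a, hb, ha, hΔa.2, hμa.1⟩
  exact cyclotomicRigidity_of_roofs P hB hroof' hcov
    ⟨ρ, isKummerDetermined_of_thetaPair 𝔉 P hK hη (cyclotomeCentral_of_unitsCentral 𝔉 hcentral) ρ hB hρB, hρ⟩

end Thm56Sub

end ThetaFrobenioid

end Literature.AnabelianGeometry.EtaleTheta
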